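import Summits.MatrixMultiplication.MatrixMultiplication.Theorems.FarEdgeDescentSubLogRatePlateau
import Summits.MatrixMultiplication.MatrixMultiplication.Theorems.FarEdgeDescentLogRate

/-!
# Route `FarEdgeDescent` — aside `SubLogRate` (stmt-MatrixMultiplication-25371), PROVED

decomp-mm ROOT cell (D-0178), lens 2 «structural dichotomy: special vs generic», gen 47 (kernel XXIII-b).
Node of record UNCHANGED: `closes (h₁ : FiniteSaturation) (h₂ : AnchoredLogConvexity) : MatrixMultiplication`.
On the special side the far-edge excess `e(k) = ω(1,k,1) − (k+1)` carries the rate ladder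
`LogRate (25370, proved) < LogRateSharp (33239, proved) < SubLogRate (25371, THIS FILE) < PowerAmortisation (25347)
< FiniteSaturation (23739)`.  The fixed-power Coppersmith–Winograd class certifies `e(k) ≤ c/log k` only for
`c > c₁ = log(3√3/4)` (`FarEdgeDescentLogRateSharp`); here the whole remainder `(0, c₁]` falls:

**THE FAR-EDGE INHERITANCE LAW** (`farEdge_inheritance`, every infinite field, every `β : ℕ`):
`limsup_{k → ∞} e(k)·log k ≤ 3·e(β)`.  DICHOTOMY at the anchor `β` (the lens): SPECIAL leaf `e(β) = 0` — then
`e ≡ 0` on `[β, ∞)` (antitone and `≥ 0`); GENERIC leaf `e(β) > 0` — then the recursion floor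
`R(⟨a, a^β, a⟩) ≥ a^{ω(1,β,1)} = a^{β+1}·a^{e(β)}` (`rpow_omegaRect_le_tensorRank`) makes the Knuth bonus
`Λ_a = (R(⟨a,a^β,a⟩) + a^β − 2a^{β+1})/a^{β+1} ≥ a^{e(β)} − 2` UNBOUNDED, while an admissible exponent
`γ < ω(1,β,1) + η` caps the plateau threshold by `M·a^{e(β)+η}` (`plateau_envelope`); choosing
`a = ⌊(k/M)^{1/(e(β)+η)}⌋` gives `e(k)·log k ≤ 3·log k/log a → 3(e(β)+η)`.  The defect at ONE far-edge format
controls the RATE at all larger ones; with `e(β) ≤ log 2/log(2β+2) → 0` (the landed aside `LogRate`) this is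
`e(k)·log k → 0`, i.e. `subLogRate : FarEdgeDescent.SubLogRate` BY NAME (§6).

Why this is new (search-before-claim, NOTES g47): Lotti–Romani 1983 Prop. 4.1 / Coppersmith 1982 give the ORDER
`1/log k` with a constant floor (`c₁` for the whole first-power CW class, `FarEdgeDescentLogRateSharp`); no
`o(1/log k)` statement for `ω(1,k,1) − k` was found in the held corpus or galaxy (queries listed in the cell memo).
The constant `3` is crude (one-letter type classes; the entropy-optimal class would give `log 2·e(β)`), which is
irrelevant for `SubLogRate`.  NO definitions (gate rule D-0009).  Leans on: the plateau file (kernel XXIII-a),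
`FarEdgeDescentLogRate.logRate`, `omegaRect_one_one_le_logb`, `rectAdmissibleExponents_nonempty`.
[cite: LottiRomani1983, Prop. 4.1] [cite: CoppersmithWinograd1982, Thm. 1] [cite: KnuthTAOCP2, §4.6.4, Ex. 67(e)]
-/

set_option linter.dupNamespace false

noncomputable section

open scoped BigOperators

namespace Summit.MatrixMultiplication.MatrixMultiplication.Theorems.FarEdgeDescentSubLogRate

open Literature.Computability.AlgebraicComplexity
open Literature.Barriers.MatrixMultiplication
open Summit.MatrixMultiplication.MatrixMultiplication.Theorems.FarEdgeDescentSubLogRatePlateau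
  (excess_plateau)

/-! ## §5 The far-edge inheritance law `limsup_k e(k)·log k ≤ 3·e(β)` -/

/-- The recursion floor in rectangular form: `a^{ω(1,β,1)} ≤ R(⟨a, a^β, a⟩)` for every `a ≥ 2` (one
algorithm for `⟨a, a^β, a⟩`, tensored up, multiplies `aˢ × a^{βs}` by `a^{βs} × aˢ` matrices;
`omegaRect_one_one_le_logb` and `ω(1,β,1) = ω(1,1,β)`). [cite: Blaser2013, Thm. 5.9] -/
theorem rpow_omegaRect_le_tensorRank (K : Type) [Field K] [Infinite K] (β : ℕ) {a : ℕ} (ha : 2 ≤ a) :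
    (a : ℝ) ^ omegaRect K 1 β 1 ≤ tensorRank (matMulTensor K a (a ^ β) a) := by
  have ha1 : (1 : ℝ) < a := by exact_mod_cast (by omega : 1 < a)
  set ρ := tensorRank (matMulTensor K a (a ^ β) a) with hρ
  have hρ' : tensorRank (matMulTensor K a a (a ^ β)) = ρ := by
    rw [hρ]; exact ((Blaser2013_lemma55 K a (a ^ β) a).2.2.2.2).symm
  have hρ0 : 0 < ρ := by
    have h1 : 2 ≤ a * a ^ β := le_trans ha (Nat.le_mul_of_pos_right a (pow_pos (by omega) β))
    have h2 : 2 ≤ a * a ^ β * a := le_trans h1 (Nat.le_mul_of_pos_right _ (by omega))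
    have h := rpow_omega_div_three_lt_tensorRank_matMulTensor K h2
    have h0 : (0 : ℝ) < ρ := lt_of_le_of_lt (Real.rpow_nonneg (Nat.cast_nonneg _) _) h
    exact_mod_cast h0
  have hA' : (a : ℝ) ^ (β : ℝ) ≤ ((a ^ β : ℕ) : ℝ) := by rw [Real.rpow_natCast]; push_cast; exact le_rfl
  have h := omegaRect_one_one_le_logb K (Nat.cast_nonneg β) (by omega : 1 < a) hA' hρ0 hρ'.le
  rw [omegaRect_one_mid_one]
  exact (Real.le_logb_iff_rpow_le ha1 (by exact_mod_cast hρ0)).1 h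

/-- **Plateau envelope (generic leaf `e(β) > 0`).**  For every `η > 0` there are `M ≥ 1` and `A` with:
for all `a ≥ A` and all real `k ≥ M · a^{e(β)+η}`, `e(k) ≤ 3 / log a`.  The two envelopes of
`ρ_a = R(⟨a, a^β, a⟩)` do the work: the floor `ρ_a ≥ a^{β+1} a^{e(β)}` (so the Knuth bonus
`Λ_a = (ρ_a + a^β − 2a^{β+1})/a^{β+1} ≥ a^{e(β)} − 2 → ∞`) and the ceiling `ρ_a ≤ C a^{γ}`, `γ < ω(1,β,1) + η`
admissible (so the plateau starts by `M a^{e(β)+η}`). [cite: LottiRomani1983, Prop. 4.1]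
[cite: CoppersmithWinograd1982, Thm. 1] -/
theorem plateau_envelope (K : Type) [Field K] [Infinite K] (β : ℕ) {η : ℝ} (hη : 0 < η)
    (he : 0 < omegaRect K 1 β 1 - (β + 1)) :
    ∃ M : ℝ, 1 ≤ M ∧ ∃ A : ℕ, 2 ≤ A ∧ ∀ a : ℕ, A ≤ a → ∀ k : ℝ,
      M * (a : ℝ) ^ (omegaRect K 1 β 1 - (β + 1) + η) ≤ k →
        omegaRect K 1 k 1 - (k + 1) ≤ 3 / Real.log a := by
  set e : ℝ := omegaRect K 1 β 1 - (β + 1) with he_def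
  -- an admissible exponent `γ < ω(1,β,1) + η` and its constant
  obtain ⟨γ, hγS, hγlt⟩ := exists_lt_of_csInf_lt (rectAdmissibleExponents_nonempty K 1 (β : ℝ) 1)
    (show sInf (rectAdmissibleExponents K 1 (β : ℝ) 1) < omegaRect K 1 β 1 + η by
      unfold omegaRect; linarith)
  obtain ⟨C, hC0, hCw⟩ := hγS.exists_pos
  obtain ⟨a₀, ha₀⟩ := Filter.eventually_atTop.1 hCw.bound
  have hup : ∀ a : ℕ, a₀ ≤ a →
      (tensorRank (matMulTensor K a (a ^ β) a) : ℝ) ≤ C * (a : ℝ) ^ γ := by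
    intro a ha
    have h := ha₀ a ha
    rw [rectDim_one, rectDim_natCast, Real.norm_natCast,
      Real.norm_of_nonneg (Real.rpow_nonneg (Nat.cast_nonneg _) _)] at h
    exact h
  have hγe : γ - ((β : ℝ) + 1) < e + η := by rw [he_def]; linarith
  set G : ℝ := |Real.log (2 * C)| / Real.log 2 + |γ| with hG
  have hl2 : 0 < Real.log 2 := Real.log_pos (by norm_num)
  have hG0 : 0 ≤ G := by positivity
  set M : ℝ := (β : ℝ) + C * G + 1 with hM
  have hM1 : 1 ≤ M := by rw [hM]; nlinarith [hC0.le, hG0, (Nat.cast_nonneg β : (0 : ℝ) ≤ β)]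
  refine ⟨M, hM1, max (max a₀ 2) ⌈(4 : ℝ) ^ (1 / e)⌉₊, le_max_of_le_left (le_max_right _ _),
    fun a ha k hk => ?_⟩
  have ha₀a : a₀ ≤ a := le_trans (le_max_left _ _) (le_trans (le_max_left _ _) ha)
  have ha2 : 2 ≤ a := le_trans (le_max_right _ _) (le_trans (le_max_left _ _) ha)
  have hac : ⌈(4 : ℝ) ^ (1 / e)⌉₊ ≤ a := le_trans (le_max_right _ _) ha
  have ha0 : (0 : ℝ) < a := by exact_mod_cast (by omega : 0 < a)
  have ha1 : (1 : ℝ) < a := by exact_mod_cast (by omega : 1 < a)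
  have hla : 0 < Real.log a := Real.log_pos ha1
  have hla2 : Real.log 2 ≤ Real.log a := Real.log_le_log (by norm_num) (by exact_mod_cast ha2)
  -- `a^e ≥ 4`
  have h4 : (4 : ℝ) ≤ (a : ℝ) ^ e := by
    have h4' : (4 : ℝ) = ((4 : ℝ) ^ (1 / e)) ^ e := by
      rw [← Real.rpow_mul (by norm_num), one_div_mul_cancel he.ne', Real.rpow_one]
    rw [h4']
    exact Real.rpow_le_rpow (Real.rpow_nonneg (by norm_num) _)
      ((Nat.le_ceil _).trans (by exact_mod_cast hac)) he.le
  -- `ρ` and its two envelopes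
  obtain ⟨ρ, hρ⟩ : ∃ ρ : ℕ, tensorRank (matMulTensor K a (a ^ β) a) = ρ := ⟨_, rfl⟩
  have hApos : (0 : ℝ) < (a : ℝ) ^ (β + 1) := pow_pos ha0 _
  have hA1 : (1 : ℝ) ≤ (a : ℝ) ^ (β + 1) := one_le_pow₀ ha1.le
  have hlow : (a : ℝ) ^ (β + 1) * (a : ℝ) ^ e ≤ ρ := by
    have h := rpow_omegaRect_le_tensorRank K β ha2
    have h' : (a : ℝ) ^ omegaRect K 1 β 1 = (a : ℝ) ^ (β + 1) * (a : ℝ) ^ e := by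
      rw [show omegaRect K 1 β 1 = ((β + 1 : ℕ) : ℝ) + e by rw [he_def]; push_cast; ring,
        Real.rpow_add ha0, Real.rpow_natCast]
    rw [h', hρ] at h
    exact h
  have hlow4 : 4 * (a : ℝ) ^ (β + 1) ≤ ρ := by nlinarith
  have hlow4N : 4 * a ^ (β + 1) ≤ ρ := by exact_mod_cast hlow4
  have hupa : (ρ : ℝ) ≤ C * (a : ℝ) ^ γ := hρ ▸ hup a ha₀a
  -- the bonus format `q`
  obtain ⟨q, hq⟩ : ∃ q : ℕ, q + 2 * a ^ (β + 1) = ρ + a ^ β :=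
    ⟨ρ + a ^ β - 2 * a ^ (β + 1), by omega⟩
  have hΛ : 2 * a ^ (β + 1) ≤ q := by omega
  refine excess_plateau K ha2 hρ hq hΛ (le_trans ?_ hk)
  -- the threshold is at most `M a^{e+η}`
  have hpowN : a ^ β ≤ a ^ (β + 1) := Nat.pow_le_pow_right (by omega) (Nat.le_succ β)
  have hqρ : (q : ℝ) ≤ ρ := by exact_mod_cast (by omega : q ≤ ρ)
  have h1 : (q : ℝ) / (a : ℝ) ^ (β + 1) ≤ C * (a : ℝ) ^ (e + η) := by
    rw [div_le_iff₀ hApos]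
    calc (q : ℝ) ≤ ρ := hqρ
      _ ≤ C * (a : ℝ) ^ γ := hupa
      _ = C * ((a : ℝ) ^ (γ - ((β + 1 : ℕ) : ℝ)) * (a : ℝ) ^ (β + 1)) := by
          rw [Real.rpow_sub ha0, Real.rpow_natCast, div_mul_cancel₀ _ hApos.ne']
      _ ≤ C * ((a : ℝ) ^ (e + η) * (a : ℝ) ^ (β + 1)) := by
          have h := Real.rpow_le_rpow_of_exponent_le ha1.le
            (show γ - ((β + 1 : ℕ) : ℝ) ≤ e + η by push_cast; linarith)
          exact mul_le_mul_of_nonneg_left (mul_le_mul_of_nonneg_right h hApos.le) hC0.le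
      _ = C * (a : ℝ) ^ (e + η) * (a : ℝ) ^ (β + 1) := by ring
  have hρpos : (0 : ℝ) < ρ := by linarith
  have haβ : (a : ℝ) ^ β ≤ ρ := by
    have : (a : ℝ) ^ β ≤ (a : ℝ) ^ (β + 1) := pow_le_pow_right₀ ha1.le (Nat.le_succ β)
    linarith
  have hlr0 : 0 ≤ Real.log ((ρ : ℝ) + (a : ℝ) ^ β) :=
    Real.log_nonneg (by linarith [pow_pos ha0 β])
  have h2 : Real.log ((ρ : ℝ) + (a : ℝ) ^ β) / Real.log a ≤ G := by
    have h2C : (ρ : ℝ) + (a : ℝ) ^ β ≤ 2 * C * (a : ℝ) ^ γ := by linarith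
    have hlog : Real.log ((ρ : ℝ) + (a : ℝ) ^ β) ≤ Real.log (2 * C) + γ * Real.log a := by
      have := Real.log_le_log (by positivity) h2C
      rwa [Real.log_mul (by positivity) (by positivity), Real.log_rpow ha0] at this
    have h3 : Real.log (2 * C) ≤ |Real.log (2 * C)| / Real.log 2 * Real.log a := by
      have h4 : |Real.log (2 * C)| ≤ |Real.log (2 * C)| / Real.log 2 * Real.log a := by
        rw [div_mul_eq_mul_div, le_div_iff₀ hl2]
        exact mul_le_mul_of_nonneg_left hla2 (abs_nonneg _)
      linarith [le_abs_self (Real.log (2 * C))]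
    have h5 : γ * Real.log a ≤ |γ| * Real.log a := mul_le_mul_of_nonneg_right (le_abs_self γ) hla.le
    rw [div_le_iff₀ hla, hG, add_mul]
    linarith
  have hae1 : 1 ≤ (a : ℝ) ^ (e + η) := Real.one_le_rpow ha1.le (by linarith)
  have hprod : (q : ℝ) / (a : ℝ) ^ (β + 1) * (Real.log ((ρ : ℝ) + (a : ℝ) ^ β) / Real.log a) ≤
      C * (a : ℝ) ^ (e + η) * G :=
    mul_le_mul h1 h2 (div_nonneg hlr0 hla.le) (by positivity)
  have hfin : (β : ℝ) + C * (a : ℝ) ^ (e + η) * G ≤ M * (a : ℝ) ^ (e + η) := by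
    rw [hM]
    nlinarith [hae1, hC0.le, hG0, (Nat.cast_nonneg β : (0 : ℝ) ≤ β)]
  linarith

/-- **THE FAR-EDGE INHERITANCE LAW** (every infinite field `K`, every `β : ℕ`):
`limsup_{k→∞} e(k)·log k ≤ 3·e(β)`, typed as: for every `ε > 0`, eventually
`e(k)·log k ≤ 3·e(β) + ε` (real `k`).  DICHOTOMY at `β`: SPECIAL leaf `e(β) = 0` — then `e(k) = 0` for all
`k ≥ β` (antitonicity and `e ≥ 0`); GENERIC leaf `e(β) > 0` — then the Knuth bonus `Λ_a ≥ a^{e(β)} − 2` is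
unbounded and the plateau envelope applies with `a = ⌊(k/M)^{1/(e(β)+η)}⌋`, `log k ≤ (e(β)+η) log a + O(1)`.
The defect at ONE far-edge format controls the RATE at all of them. [cite: LottiRomani1983, Prop. 4.1]
[cite: CoppersmithWinograd1982, Thm. 1] [cite: KnuthTAOCP2, §4.6.4, Ex. 67(e)] -/
theorem farEdge_inheritance (K : Type) [Field K] [Infinite K] (β : ℕ) {ε : ℝ} (hε : 0 < ε) :
    ∃ k₀ : ℝ, ∀ k : ℝ, k₀ ≤ k →
      (omegaRect K 1 k 1 - (k + 1)) * Real.log k ≤ 3 * (omegaRect K 1 β 1 - (β + 1)) + ε := by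
  set e : ℝ := omegaRect K 1 β 1 - (β + 1) with he_def
  have he0 : 0 ≤ e := by
    have := one_le_omegaRect_one_mid_one_sub K (β : ℝ); rw [he_def]; linarith
  have hek_le : ∀ k : ℝ, (β : ℝ) ≤ k → omegaRect K 1 k 1 - (k + 1) ≤ e := fun k hk => by
    have := omegaRect_one_mid_one_sub_antitone K hk
    simp only at this
    rw [he_def]; linarith
  have hek_nonneg : ∀ k : ℝ, 0 ≤ omegaRect K 1 k 1 - (k + 1) := fun k => by
    have := one_le_omegaRect_one_mid_one_sub K k; linarith
  rcases he0.eq_or_lt with he | he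
  · -- SPECIAL leaf: finite saturation at `β`
    refine ⟨β, fun k hk => ?_⟩
    have h0 : omegaRect K 1 k 1 - (k + 1) = 0 :=
      le_antisymm (le_trans (hek_le k hk) he.symm.le) (hek_nonneg k)
    rw [h0, zero_mul]
    linarith
  · -- GENERIC leaf
    set η : ℝ := ε / 8 with hη
    have hη0 : 0 < η := by positivity
    obtain ⟨M, hM1, A, hA2, hplat⟩ := plateau_envelope K β hη0 he
    have hM0 : 0 < M := by linarith
    set s : ℝ := e + η with hs
    have hs0 : 0 < s := by linarith
    set L : ℝ := Real.log M + s * Real.log 2 with hL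
    have hl2 : 0 < Real.log 2 := Real.log_pos (by norm_num)
    have hL0 : 0 ≤ L := by
      have := Real.log_nonneg hM1; rw [hL]; positivity
    set A' : ℕ := max A ⌈Real.exp (3 * L / η)⌉₊ with hA'
    refine ⟨M * ((A' : ℝ) + 1) ^ s, fun k hk => ?_⟩
    have hk0 : 0 < k := lt_of_lt_of_le (by positivity) hk
    have hkM : 0 ≤ k / M := div_nonneg hk0.le hM0.le
    -- `a = ⌊(k/M)^{1/s}⌋`
    set y : ℝ := (k / M) ^ s⁻¹ with hy
    have hy0 : 0 ≤ y := Real.rpow_nonneg hkM _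
    have hys : y ^ s = k / M := by rw [hy, Real.rpow_inv_rpow hkM hs0.ne']
    have hyA : (A' : ℝ) + 1 ≤ y := by
      have h1 : ((A' : ℝ) + 1) ^ s ≤ k / M := by rw [le_div_iff₀' hM0]; exact hk
      have h2 := Real.rpow_le_rpow (by positivity) h1 (inv_nonneg.2 hs0.le)
      rwa [Real.rpow_rpow_inv (by positivity) hs0.ne'] at h2
    set a : ℕ := ⌊y⌋₊ with ha
    have haA' : A' ≤ a := Nat.le_floor (by linarith)
    have haA : A ≤ a := le_trans (le_max_left _ _) haA'
    have hay : (a : ℝ) ≤ y := Nat.floor_le hy0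
    have hya : y < (a : ℝ) + 1 := Nat.lt_floor_add_one y
    have ha2 : (2 : ℝ) ≤ a := by exact_mod_cast hA2.trans haA
    have ha0 : (0 : ℝ) < a := by linarith
    have hla : 0 < Real.log a := Real.log_pos (by linarith)
    -- `M aˢ ≤ k < M (a+1)ˢ`
    have hk_ge : M * (a : ℝ) ^ s ≤ k := by
      have h1 : (a : ℝ) ^ s ≤ y ^ s := Real.rpow_le_rpow ha0.le hay hs0.le
      rw [hys, le_div_iff₀' hM0] at h1
      exact h1
    have hk_lt : k < M * ((a : ℝ) + 1) ^ s := by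
      have h1 : y ^ s < ((a : ℝ) + 1) ^ s := Real.rpow_lt_rpow hy0 hya hs0
      rw [hys, div_lt_iff₀' hM0] at h1
      exact h1
    -- the plateau and the size of `log k`
    have hek := hplat a haA k hk_ge
    have has1 : 1 ≤ (a : ℝ) ^ s := Real.one_le_rpow (by linarith) hs0.le
    have hlogk0 : 0 ≤ Real.log k := Real.log_nonneg (by nlinarith)
    have hlogk : Real.log k ≤ L + s * Real.log a := by
      have h1 := Real.log_le_log hk0 hk_lt.le
      rw [Real.log_mul hM0.ne' (by positivity), Real.log_rpow (by positivity)] at h1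
      have h2 : Real.log ((a : ℝ) + 1) ≤ Real.log 2 + Real.log a := by
        rw [← Real.log_mul (by norm_num) ha0.ne']
        exact Real.log_le_log (by positivity) (by linarith)
      rw [hL]
      nlinarith [h1, h2, hs0]
    have hLa : 3 * L / Real.log a ≤ η := by
      have h1 : Real.exp (3 * L / η) ≤ a :=
        le_trans (Nat.le_ceil _) (by exact_mod_cast (le_max_right _ _).trans haA')
      have h2 : 3 * L / η ≤ Real.log a := (Real.le_log_iff_exp_le ha0).2 h1
      rw [div_le_iff₀ hla]
      rw [div_le_iff₀ hη0] at h2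
      linarith
    calc (omegaRect K 1 k 1 - (k + 1)) * Real.log k
        ≤ 3 / Real.log a * Real.log k := mul_le_mul_of_nonneg_right hek hlogk0
      _ ≤ 3 / Real.log a * (L + s * Real.log a) := mul_le_mul_of_nonneg_left hlogk (by positivity)
      _ = 3 * L / Real.log a + 3 * s := by field_simp
      _ ≤ η + 3 * (e + η) := by rw [hs]; linarith
      _ ≤ 3 * e + ε := by rw [hη]; linarith

/-! ## §6 The aside `SubLogRate` (stmt-MatrixMultiplication-25371) -/

/-- **`SubLogRate` holds**: `e(k) = ω(1,k,1) − (k+1) = o(1/log k)`, i.e. for every `c > 0`, eventually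
`e(k) ≤ c / log k`.  From the inheritance law at a `β` with `3·e(β) ≤ c/4` — such a `β` exists by the
LANDED aside `LogRate` (`e(β) ≤ log 2 / log(2β+2)`, Coppersmith 1982 / Lotti–Romani 1983) — and
`ε = c/2`.  This closes item stmt-MatrixMultiplication-25371 of `route-MatrixMultiplication-FarEdgeDescent`
by name. [cite: LottiRomani1983, Prop. 4.1] [cite: CoppersmithWinograd1982, Thm. 1] -/
theorem subLogRate : Summit.MatrixMultiplication.MatrixMultiplication.Theses.FarEdgeDescent.SubLogRate := by
  intro c hc
  set β : ℕ := ⌈Real.exp (12 * Real.log 2 / c)⌉₊ + 1 with hβ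
  have hβ1 : 1 ≤ β := by omega
  have hLR := Summit.MatrixMultiplication.MatrixMultiplication.Theorems.FarEdgeDescentLogRate.logRate β hβ1
  have hl2 : 0 < Real.log 2 := Real.log_pos (by norm_num)
  have heβ : omegaRect ℂ 1 β 1 - ((β : ℝ) + 1) ≤ c / 12 := by
    have h1 : Real.exp (12 * Real.log 2 / c) ≤ 2 * (β : ℝ) + 2 := by
      have h := Nat.le_ceil (Real.exp (12 * Real.log 2 / c))
      have h' : (⌈Real.exp (12 * Real.log 2 / c)⌉₊ : ℝ) ≤ β := by
        rw [hβ]; push_cast; linarith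
      linarith [(Nat.cast_nonneg β : (0 : ℝ) ≤ β)]
    have h2 : 12 * Real.log 2 / c ≤ Real.log (2 * (β : ℝ) + 2) :=
      (Real.le_log_iff_exp_le (by positivity)).2 h1
    have hl0 : 0 < Real.log (2 * (β : ℝ) + 2) := lt_of_lt_of_le (by positivity) h2
    have h3 : Real.log 2 / Real.log (2 * (β : ℝ) + 2) ≤ c / 12 := by
      rw [div_le_iff₀ hl0]
      rw [div_le_iff₀ hc] at h2
      linarith
    have h4 : omegaRect ℂ 1 β 1 ≤ (β : ℝ) + 1 + Real.log 2 / Real.log (2 * (β : ℝ) + 2) := hLR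
    linarith
  obtain ⟨k₀, hk₀⟩ := farEdge_inheritance ℂ β (by positivity : 0 < c / 2)
  refine ⟨max 2 ⌈k₀⌉₊, le_max_left _ _, fun k hk => ?_⟩
  have hk2 : 2 ≤ k := (le_max_left _ _).trans hk
  have hkk₀ : k₀ ≤ (k : ℝ) :=
    (Nat.le_ceil k₀).trans (by exact_mod_cast (le_max_right _ _).trans hk)
  have h := hk₀ k hkk₀
  have hlk : 0 < Real.log (k : ℝ) := Real.log_pos (by exact_mod_cast (by omega : 1 < k))
  rw [le_div_iff₀ hlk]
  linarith

end Summit.MatrixMultiplication.MatrixMultiplication.Theorems.FarEdgeDescentSubLogRate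

end
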